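import Literature.NumberTheory.Automorphic.RamakrishnanTheoremMProofs
import Literature.NumberTheory.Automorphic.PairLFunctionPolesRepDataRealisation
import Literature.NumberTheory.Automorphic.GLnCentralCharacter
import Literature.NumberTheory.Automorphic.GLOneOfHeckeCharacter
import Literature.NumberTheory.Automorphic.AutomorphicRepsGLIrreducibleL2HCHolds
import Literature.NumberTheory.GaloisRepresentations.HeckeLFunctionNonvanishingLineProofs
import HarnessLib

/-!
# Ramakrishnan (2000), Theorem M: the "only if" half of the cuspidality criterion
# (`π ⊠ (π ⊗ χ)` is never cuspidal) from Jacquet–Shalika, and Theorem M modulo the cuspidal-case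
# fact, the degenerate Existence clause and the Jacquet–Shalika / Borel–Jacquet leaves

Topic `NumberTheory/Automorphic`; namespace `Literature.NumberTheory.Automorphic`. Second sibling
proof file (theorems only: no definition, no named fact, no `sorry`) of
`RamakrishnanTensorProductGL2`, continuing `RamakrishnanTheoremMProofs`, towards the named fact
`Ramakrishnan2000_theoremM` — D. Ramakrishnan, *Modularity of the Rankin–Selberg `L`-series, and
multiplicity one for `SL(2)`*, Ann. of Math. (2) **152** (2000), 45–111 [Ramakrishnan2000],
**Theorem M** (§3; preprint `paper:galaxy-pdf-4279542020`, p. 9).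

## The printed step and what is proved

`RamakrishnanTheoremMProofs` reduced `Ramakrishnan2000_theoremM` to the cuspidal-case fact
`Ramakrishnan2000_boxTimes_cuspidal` plus two clauses stated inline: (R1) Existence of `π ⊠ π'` for
every cuspidal pair, and (R2) the "only if" half of the cuspidality criterion
(`Ramakrishnan2000_theoremM.of_boxTimes_cuspidal`). This file **proves (R2) from the standard
leaves of the tree**, following the printed argument — op. cit. §3.2, proof of Prop. 3.2.1,
preprint p. 14 (chunk 20 of the held copy), verbatim:

> "First suppose `π ⊠ π'` is cuspidal. […] Suppose `π' ≃ π ⊗ χ`, for an idele class character `χ`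
> of `F`. Then, by [JS2] and `(L_v)` for almost all `v`, `L^S(s, π ⊠ π' ⊗ (χω)⁻¹)` must have a
> pole at `s = 1`, with `S` denoting the set of ramified and archimedean places, and `ω` the
> central character of `π`. (We are using the fact that `π ⊗ ω⁻¹` is the contragredient `π^∨` of
> `π`.) Then `π ⊠ π'` cannot be cuspidal, leading to a contradiction."

In the tree's vocabulary (Satake parameters at almost all finite places; `satakeTensor` = `⊗`;
the partial Rankin–Selberg `L`-functions `partialPairL` of `PairLFunctionBaseChange`; the
Jacquet–Shalika statements (2.2)–(2.3) of Arthur–Clozel, Ch. 3 §2, as rendered in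
`PairLFunctionPoles`):

* `satakeTensor_self_map_prod_inv_mul_of_card_eq_two` — the local identity behind `(L_v)` and
  "`π ⊗ ω⁻¹ = π^∨`": `(t ⊗ t) · (det t)⁻¹ = t ⊗ t⁻¹` for `t ∈ GL₂(ℂ)` semisimple
  (`{a², ab, ab, b²}/(ab) = {a/b, 1, 1, b/a}`), so that with `t_{π'} = χ(ϖ) t_π` the unramified
  factors of `L^S(s, (π ⊠ π') ⊗ (χω)⁻¹)` are those of `L^S(s, π × π^∨)`.
* `CuspidalAutomorphicRepGL.false_of_satakeTensor_self_twist` — **the pole argument in the `L²`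
  model**: for cuspidal `π₀ ⊂ L²_cusp(GL₂)`, `P₀ ⊂ L²_cusp(GL₄)` with `t_{P₀} = ψ(ϖ) (t_{π₀} ⊗ t_{π₀})`
  off a finite set, (2.2) at `s = 1` for `GL₄ × GL₁` and (2.3) for `GL₂` are contradictory. The
  character `ν = (ψ ω₀)⁻¹` (`ω₀ = ω_{π₀}`, `CuspidalAutomorphicRepGL.exists_centralCharacter`; `ν⁴ =
  ω_{P₀}⁻¹` makes `ν` unitary and trivial on `A_G`,
  `HeckeCharacter.isUnitary_and_map_posRealIdele_of_pow_four`) is realised on `GL₁`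
  (`CuspidalAutomorphicRepGL.exists_heckeCharacter_eq`), `L^S(s, P₀ × ν) = L^S(s, π₀ × π̄₀)`
  identically (`t_{π̄₀} = t_{π₀}⁻¹`, `IsSatakeFamilyOf.map_inv_eq_map_conj`), the left side has a
  finite limit at `s = 1` ((2.2), ranks `4 ≠ 1` — the tree's form of "[JS2]: `L^S(s, Π ⊗ ν)` is
  holomorphic at `s = 1` for cuspidal `Π` on `GL(4)`") and the right side a pole ((2.3),
  `not_tendsto_partialPairL_conj_of_pole`).
* `Ramakrishnan2000_theoremM.not_exists_cuspidal_of_isSatakeTwistBy_of_normalisation` — **(R2) for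
  Borel–Jacquet data** (`CuspidalAutomorphicRepData`, arbitrary central characters, the model of
  `Ramakrishnan2000_theoremM`): if `π' ≃ π ⊗ χ` at the level of Satake parameters a.e.
  (`IsSatakeTwistBy`), no cuspidal `Π` on `GL(4)/F` has Satake parameters `t_π ⊗ t_{π'}` a.e.;
  granting the two `L²` facts and the unitary normalisation `hN` of cuspidal Borel–Jacquet data
  ("`π = π₀ ⊗ |det|^s`, `π₀` unitary", Borel–Jacquet 1979, 5.7 — the hypothesis shared with
  `ArthurClozel_fibres_quadratic_of_normalisation` and the `…_repData_of_normalisation` theorems of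
  `PairLFunctionPolesRepDataRealisation`); `…_of_realisation_leaves` feeds `hN` from the two
  dictionary leaves `AutomorphicRepsGL.exists_le_formsOfL2_of_W'_eq_bot` and
  `AutomorphicRepsGL.stable_cuspidal_eq_sSup_irreducible`
  (`CuspidalAutomorphicRepData.exists_satake_eq_cpow_mul_L2_of_realisation`).
* `Ramakrishnan2000_theoremM.of_boxTimes_cuspidal_of_normalisation`,
  `…_of_realisation_leaves` — **assembly**: `Ramakrishnan2000_theoremM` from
  `Ramakrishnan2000_boxTimes_cuspidal`, (R1), and the leaves
  {`JacquetShalika1981_partialPairL_at_one_of_rank_ne`, `JacquetShalika1981_partialPairL_pole_of_eq_conj`,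
  `exists_le_formsOfL2_of_W'_eq_bot`, `stable_cuspidal_eq_sSup_irreducible`} (named facts of the
  tree, none discharged yet).

* `Ramakrishnan2000_theoremM.exists_of_boxTimes_cuspidal_of_special_types` — **the case split
  of op. cit. Lemma 3.1.1** for the Existence clause: `π ⊠ π'` exists for every cuspidal pair as
  soon as it exists for pairs of *general type* (the fact `Ramakrishnan2000_boxTimes_cuspidal`) and
  in the two special types that occur for cuspidal `π, π'` — (II) one of `π, π'` admits a
  non-trivial self-twist (by the symmetry `t ⊗ t' = t' ⊗ t` it suffices to treat `π`), (III)
  neither does and `π' ≃ π ⊗ χ` — kept as hypotheses in their printed form (their printed proofs,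
  `π ⊠ I(μ) = I_K^F(π_K ⊗ μ)` and `π ⊠ (π ⊗ χ) = (sym²(π) ⊗ χ) ⊞ ωχ`, need automorphic induction
  `GL(2)/K → GL(4)/F` of non-cuspidal data and isobaric sums, absent from the tree).
* `Ramakrishnan2000_theoremM.not_exists_cuspidal_of_isSatakeTwistBy_of_semisimple`,
  `Ramakrishnan2000_theoremM.of_boxTimes_cuspidal_of_special_types` — the same statements with the
  realisation leaf **discharged**: `AutomorphicRepsGL.exists_le_formsOfL2_of_W'_eq_bot` is now the
  theorem `AutomorphicRepsGL.exists_le_formsOfL2_of_W'_eq_bot_holds`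
  (`AutomorphicRepsGLIrreducibleL2HCHolds`), so that (R2), and Theorem M granting the cuspidal-case
  fact and Lemma 3.1.1 (II), (III), rest on the three named facts
  {`JacquetShalika1981_partialPairL_at_one_of_rank_ne`, `JacquetShalika1981_partialPairL_pole_of_eq_conj`,
  `AutomorphicRepsGL.stable_cuspidal_eq_sSup_irreducible`}.

## What remains for `Ramakrishnan2000_theoremM_holds` (not in this file)

`Ramakrishnan2000_boxTimes_cuspidal` (Theorem M, cuspidal case — the apex theorem of op. cit.:
converse theorem for `GL(4)`, triple product `L`-functions, base change and descent; see the
status paragraph of `RamakrishnanTheoremMProofs` and `RamakrishnanBoxTimesProofs`), (R1) (op. cit.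
Lemma 3.1.1 (II), (III): `π ⊠ I(μ) = I_K^F(π_K ⊗ μ)` and `π ⊠ (π ⊗ χ) = (sym²(π) ⊗ χ) ⊞ ωχ` — automorphic
induction `GL(2)/K → GL(4)/F` and isobaric sums, neither in the tree), and the three named facts
listed above. Nothing here assumes `Ramakrishnan2000_theoremM`.

## References

* [Ramakrishnan2000] D. Ramakrishnan, *Modularity of the Rankin–Selberg `L`-series, and
  multiplicity one for `SL(2)`*, Ann. of Math. (2) 152 (2000), 45–111, doi:10.2307/2661379:
  Theorem M (§3, preprint p. 9), Lemma 3.1.1, Prop. 3.2.1 and its proof (§3.2, preprint p. 14).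
* [ArthurClozelAMS120] J. Arthur, L. Clozel, *Simple algebras, base change, and the advanced
  theory of the trace formula*, Ann. of Math. Stud. 120 (1989), Ch. 3 §2, (2.2)–(2.3), p. 171.
* [JacquetShalikaAJM1981II] H. Jacquet, J. A. Shalika, *On Euler products and the classification
  of automorphic forms II*, Amer. J. Math. 103 (1981), 777–815, Prop. 3.6 ("[JS2]").
* [BorelJacquetCorvallis1979] A. Borel, H. Jacquet, *Automorphic forms and automorphic
  representations*, Proc. Sympos. Pure Math. 33 (1979), part 1, §4.6, 5.7.
* [TateThesis1967] J. Tate, *Fourier analysis in number fields and Hecke's zeta-functions*, in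
  Cassels–Fröhlich (1967), §4.3 (the quasi-characters `|·|^s`).
-/

noncomputable section

open scoped MatrixGroups Topology Classical NNReal
open NumberField IsDedekindDomain MeasureTheory Filter

namespace Literature.NumberTheory.Automorphic

open AdelicGroupData
open Literature.NumberTheory.GaloisRepresentations (HeckeCharacter ideleGroup ideleNorm)

/-! ### Multiset algebra: `(t ⊗ t) · (det t)⁻¹ = t ⊗ t⁻¹` in rank two -/

section Algebra

/-- Tensoring with a one-element parameter on the right multiplies every entry:
`α ⊗ {c} = {a c}` (private copy of `satakeTensor_singleton_right` of the analytic file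
`PairLFunctionPolesRankNeTwist`, not imported here). [folklore] -/
private theorem satakeTensor_singleton_right' (α : Multiset ℂ) (c : ℂ) :
    satakeTensor α {c} = α.map (· * c) := by
  induction α using Multiset.induction_on with
  | empty => simp
  | cons a α ih =>
    rw [satakeTensor_cons_left, ih, Multiset.map_singleton, Multiset.map_cons,
      Multiset.singleton_add]

/-- **`(t_π ⊗ t_π) ⊗ ω(ϖ)⁻¹ = t_π ⊗ t_π^∨` for `GL(2)`**: for a two-element multiset `α = {a, b}`
with non-zero entries, `{a², ab, ab, b²} · (ab)⁻¹ = {a/b, 1, 1, b/a} = {a, b} ⊗ {a⁻¹, b⁻¹}` — the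
unramified shadow of "`π ⊗ ω⁻¹` is the contragredient `π^∨` of `π`" (Ramakrishnan 2000, proof of
Prop. 3.2.1) combined with `(π ⊠ π') ⊗ ν`, `π' = π ⊗ χ`, `ν = (χω)⁻¹`.
[cite: Ramakrishnan2000, §3.2, proof of Prop. 3.2.1 (preprint p. 14)] -/
theorem satakeTensor_self_map_prod_inv_mul_of_card_eq_two {α : Multiset ℂ}
    (hα : Multiset.card α = 2) (h0 : (0 : ℂ) ∉ α) :
    (satakeTensor α α).map (α.prod⁻¹ * ·) = satakeTensor α (α.map (·⁻¹)) := by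
  obtain ⟨a, b, rfl⟩ := Multiset.card_eq_two.1 hα
  have ha : a ≠ 0 := fun h => h0 (by simp [h])
  have hb : b ≠ 0 := fun h => h0 (by simp [h])
  have hmap : ({a, b} : Multiset ℂ).map (·⁻¹) = {a⁻¹, b⁻¹} := by simp
  rw [hmap, satakeTensor_pair_pair, satakeTensor_pair_pair]
  simp only [Multiset.insert_eq_cons, Multiset.map_cons, Multiset.map_singleton,
    Multiset.prod_cons, Multiset.prod_singleton]
  -- both sides are explicit four-element multisets
  have e1 : (a * b)⁻¹ * (a * a) = a * b⁻¹ := by field_simp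
  have e2 : (a * b)⁻¹ * (a * b) = 1 := inv_mul_cancel₀ (mul_ne_zero ha hb)
  have e3 : (a * b)⁻¹ * (b * a) = 1 := by rw [mul_comm b a]; exact e2
  have e4 : (a * b)⁻¹ * (b * b) = b * a⁻¹ := by field_simp
  rw [e1, e2, e3, e4, mul_inv_cancel₀ ha, mul_inv_cancel₀ hb]
  -- `{a/b, 1, 1, b/a} = {1, a/b, b/a, 1}`
  rw [Multiset.cons_swap (a * b⁻¹) 1]
  congr 2
  exact Multiset.pair_comm _ _

/-- `∏ (α ⊗ β) = (∏ α)^{|β|} (∏ β)^{|α|}` (`det(A ⊗ B) = (det A)^m (det B)^n`; private copy of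
`prod_satakeTensor` of `RamakrishnanBoxTimesProofs`, not imported here). [folklore] -/
private theorem prod_satakeTensor' (α β : Multiset ℂ) :
    (satakeTensor α β).prod = α.prod ^ Multiset.card β * β.prod ^ Multiset.card α := by
  induction α using Multiset.induction_on with
  | empty => simp [satakeTensor_zero_left]
  | cons a α ih =>
    rw [satakeTensor_cons_left, Multiset.prod_add, ih, Multiset.prod_map_mul, Multiset.map_const',
      Multiset.prod_replicate, Multiset.map_id', Multiset.prod_cons, Multiset.card_cons]
    ring

/-- `∏ (c · X) = c^{|X|} ∏ X`. [folklore] -/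
private theorem prod_map_const_mul' (c : ℂ) (X : Multiset ℂ) :
    (X.map (c * ·)).prod = c ^ Multiset.card X * X.prod := by
  rw [Multiset.prod_map_mul, Multiset.map_const', Multiset.prod_replicate, Multiset.map_id']

end Algebra

/-! ### Hecke characters: values at uniformizers, norm powers, fourth roots of unitary characters -/

section Characters

variable {K : Type} [Field K] [NumberField K]

/-- `(χ ψ)(ϖ_v) = χ(ϖ_v) ψ(ϖ_v)`. [folklore] -/
private theorem vAU_mul (χ ψ : HeckeCharacter K) (v : HeightOneSpectrum (𝓞 K)) :
    (χ * ψ).valueAtUniformizer v = χ.valueAtUniformizer v * ψ.valueAtUniformizer v := by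
  simp only [HeckeCharacter.valueAtUniformizer, HeckeCharacter.localComponent_apply,
    HeckeCharacter.mul_apply, Units.val_mul]

/-- `χ⁻¹(ϖ_v) = χ(ϖ_v)⁻¹`. [folklore] -/
private theorem vAU_inv (χ : HeckeCharacter K) (v : HeightOneSpectrum (𝓞 K)) :
    χ⁻¹.valueAtUniformizer v = (χ.valueAtUniformizer v)⁻¹ := by
  simp only [HeckeCharacter.valueAtUniformizer, HeckeCharacter.localComponent_apply,
    HeckeCharacter.inv_apply, Units.val_inv_eq_inv_val]

/-- `χ(ϖ_v) ≠ 0`. [folklore] -/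
private theorem vAU_ne_zero (χ : HeckeCharacter K)
    (v : HeightOneSpectrum (𝓞 K)) : χ.valueAtUniformizer v ≠ 0 := by
  simp only [HeckeCharacter.valueAtUniformizer]
  exact Units.ne_zero _

/-- **`‖·‖^z(ϖ_v) = q_v^{-z}`** with `q_v = v.residueCard` (`= N(v)`):
`HeckeCharacter.valueAtUniformizer_of_forall_apply_eq_cpow` restated with the residue cardinality
of the automorphic files. [cite: TateThesis1967, §4.3] -/
private theorem vAU_of_forall_apply_eq_cpow {ν : HeckeCharacter K}
    {z : ℂ} (hν : ∀ x : ideleGroup K, ((ν x : ℂˣ) : ℂ) = ((ideleNorm x : ℝ) : ℂ) ^ z)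
    (v : HeightOneSpectrum (𝓞 K)) :
    ν.valueAtUniformizer v = (v.residueCard : ℂ) ^ (-z) :=
  HeckeCharacter.valueAtUniformizer_of_forall_apply_eq_cpow hν v

/-- **Fourth roots of unitary, `A_G`-trivial Hecke characters are unitary and `A_G`-trivial**:
if `ν⁴` has absolute value `1` and is trivial on the positive reals `A_G = ℝ_{>0} ↪ 𝕀_K`
(`posRealIdele`), then so is `ν` (`|ν| ≥ 0` with `|ν|⁴ = 1`; every `t > 0` is a fourth power
`t = u⁴` in `ℝ_{>0}`, so `ν(t) = ν⁴(u) = 1`). [folklore] -/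
theorem _root_.Literature.NumberTheory.GaloisRepresentations.HeckeCharacter.isUnitary_and_map_posRealIdele_of_pow_four
    {ν : HeckeCharacter K}
    (hu : (ν ^ 4).IsUnitary) (hA : ∀ t : ℝ≥0ˣ, (ν ^ 4) (posRealIdele K t) = 1) :
    ν.IsUnitary ∧ ∀ t : ℝ≥0ˣ, ν (posRealIdele K t) = 1 := by
  refine ⟨fun x => ?_, fun t => ?_⟩
  · have h := hu x
    rw [HeckeCharacter.pow_apply, Units.val_pow_eq_pow_val, norm_pow] at h
    exact (pow_eq_one_iff_of_nonneg (norm_nonneg _) (by norm_num)).1 h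
  · -- `t = u⁴` with `u = t^{1/4}`
    have ht0 : (t : ℝ≥0) ≠ 0 := t.ne_zero
    set r : ℝ≥0 := (t : ℝ≥0) ^ ((4 : ℕ) : ℝ)⁻¹ with hr
    have hr0 : r ≠ 0 := by
      rw [hr]
      exact (NNReal.rpow_pos (pos_iff_ne_zero.2 ht0)).ne'
    set u : ℝ≥0ˣ := Units.mk0 r hr0 with hu'
    have hut : u ^ 4 = t := by
      ext
      rw [Units.val_pow_eq_pow_val, hu', Units.val_mk0, hr, NNReal.rpow_inv_natCast_pow _ four_ne_zero]
    have h := hA u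
    rw [HeckeCharacter.pow_apply, ← map_pow, ← map_pow, hut] at h
    exact h

/-- `(χ ^ i)(ϖ_v) = χ(ϖ_v)^i` (private copy of `HeckeCharacter.valueAtUniformizer_pow` of
`PairLFunctionBaseChangeAutomorphic`). [folklore] -/
private theorem vAU_pow (χ : HeckeCharacter K) (i : ℕ)
    (v : HeightOneSpectrum (𝓞 K)) :
    (χ ^ i).valueAtUniformizer v = χ.valueAtUniformizer v ^ i := by
  simp only [HeckeCharacter.valueAtUniformizer, HeckeCharacter.localComponent_apply,
    HeckeCharacter.pow_apply, Units.val_pow_eq_pow_val]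

end Characters

/-! ### The core of the argument in the `L²` model

For `π₀ ⊂ L²_cusp(GL₂)` and `P₀ ⊂ L²_cusp(GL₄)` whose Hecke matrices satisfy
`t_{P₀,w} = ψ(ϖ_w) (t_{π₀,w} ⊗ t_{π₀,w})` off a finite set, Jacquet–Shalika (2.2) (ranks `4 ≠ 1`)
and (2.3) (rank `2`) are contradictory: with `ω₀ = ω_{π₀}` and `ν = (ψ ω₀)⁻¹` (a unitary idele class
character trivial on `A_G`, realised on `GL(1)`), `L^S(s, P₀ × ν) = L^S(s, π₀ × π̄₀)` factor by
factor (`(t ⊗ t) (det t)⁻¹ = t ⊗ t⁻¹ = t ⊗ t̄`), the left side has a finite limit at `s = 1` and the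
right side a pole. -/

section L2Core

variable {F : Type} [Field F] [NumberField F]
  {μ₂ : Measure (gl 2 F).automorphicQuotient} [(gl 2 F).IsAutomorphicMeasure μ₂]
  {μ₄ : Measure (gl 4 F).automorphicQuotient} [(gl 4 F).IsAutomorphicMeasure μ₄]
  {μ₁ : Measure (gl 1 F).automorphicQuotient} [(gl 1 F).IsAutomorphicMeasure μ₁]

/-- **Ramakrishnan's pole argument in the `L²` model** (op. cit. §3.2, proof of Prop. 3.2.1,
preprint p. 14: "Suppose `π' ≃ π ⊗ χ` … Then, by [JS2] and `(L_v)` for almost all `v`,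
`L^S(s, π ⊠ π' ⊗ (χω)⁻¹)` must have a pole at `s = 1` … `ω` the central character of `π`. (We are
using the fact that `π ⊗ ω⁻¹` is the contragredient `π^∨` of `π`.) Then `π ⊠ π'` cannot be
cuspidal"). Let `π₀ ⊂ L²_cusp(GL₂(F) A_G \ GL₂(𝔸_F))` and `P₀ ⊂ L²_cusp(GL₄)` be cuspidal with Satake
families `α`, `γ` off a finite `S`, and `ψ` a Hecke character with
`γ(w) = ψ(ϖ_w) · (α(w) ⊗ α(w))` for `w ∉ S` (the Hecke matrices of a cuspidal `π ⊠ (π ⊗ χ)`, up to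
the unitary normalisations). Granting Jacquet–Shalika (2.2) at `s = 1` for `GL₄ × GL₁`
(`JacquetShalika1981_partialPairL_at_one_of_rank_ne`) and (2.3) for `GL₂`
(`JacquetShalika1981_partialPairL_pole_of_eq_conj`), this is absurd: with `ω₀` the central character
of `π₀` (`ω₀(ϖ_w) = det α(w)`, `CuspidalAutomorphicRepGL.exists_centralCharacter`) and `Ω` that of
`P₀`, `Ω = (ψω₀)⁴`, so `ν = (ψω₀)⁻¹` is unitary and trivial on `A_G` and is the Hecke character of a
cuspidal `N` on `GL₁` (`CuspidalAutomorphicRepGL.exists_heckeCharacter_eq`); then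
`L^S(s, P₀ × N) = L^S(s, π₀ × π̄₀)` identically (`t_{π̄₀} = t_{π₀}⁻¹`,
`IsSatakeFamilyOf.map_inv_eq_map_conj`; `satakeTensor_self_map_prod_inv_mul_of_card_eq_two`), whose
left side tends to a finite limit at `s = 1` ((2.2), `4 ≠ 1`) while the right side has a pole
((2.3), `not_tendsto_partialPairL_conj_of_pole`).
[cite: Ramakrishnan2000, §3.2, proof of Prop. 3.2.1 (preprint p. 14)]
[cite: ArthurClozelAMS120, Ch. 3 §2 (2.2)–(2.3)] -/
theorem CuspidalAutomorphicRepGL.false_of_satakeTensor_self_twist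
    (hrk : JacquetShalika1981_partialPairL_at_one_of_rank_ne (n := 4) (m := 1) (K := F) (μ := μ₄)
      (μ' := μ₁))
    (h23 : JacquetShalika1981_partialPairL_pole_of_eq_conj (n := 2) (K := F) (μ := μ₂))
    (π₀ : CuspidalAutomorphicRepGL 2 F μ₂) (P₀ : CuspidalAutomorphicRepGL 4 F μ₄)
    {S : Set (HeightOneSpectrum (𝓞 F))} (hS : S.Finite) {α γ : SatakeFamily F}
    (hα : IsSatakeFamilyOf π₀ S α) (hγ : IsSatakeFamilyOf P₀ S γ) (ψ : HeckeCharacter F)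
    (h : ∀ w ∉ S, γ w = (satakeTensor (α w) (α w)).map (ψ.valueAtUniformizer w * ·)) : False := by
  classical
  -- central characters `ω₀` of `π₀` and `Ω` of `P₀`
  obtain ⟨ω₀, -, -, -, -, hω₀sat⟩ := π₀.exists_centralCharacter
  obtain ⟨Ω, hΩu, hΩA, -, -, hΩsat⟩ := P₀.exists_centralCharacter
  -- `Ω = (ψ ω₀)⁴`, comparing values at almost all uniformizers
  have hΩ : Ω = (ψ * ω₀) ^ 4 := by
    refine HeckeCharacter.ext_of_eventually_valueAtUniformizer_eq ?_
    refine hS.eventually_cofinite_notMem.mono fun w hw => ?_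
    rw [(hΩsat hγ w hw).2, h w hw, prod_map_const_mul', card_satakeTensor, prod_satakeTensor',
      hα.card_eq hw, vAU_pow, vAU_mul, (hω₀sat hα w hw).2]
    ring
  -- `ν = (ψ ω₀)⁻¹` is unitary and trivial on `A_G`, since `ν⁴ = Ω⁻¹` is
  set ν : HeckeCharacter F := (ψ * ω₀)⁻¹ with hν
  have hν4 : ν ^ 4 = Ω⁻¹ := by rw [hν, inv_pow, hΩ]
  obtain ⟨hνu, hνA⟩ : ν.IsUnitary ∧ ∀ t : ℝ≥0ˣ, ν (posRealIdele F t) = 1 := by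
    refine HeckeCharacter.isUnitary_and_map_posRealIdele_of_pow_four ?_ fun t => ?_
    · rw [hν4]; exact hΩu.inv
    · rw [hν4, HeckeCharacter.inv_apply, hΩA t, inv_one]
  -- the cuspidal `N` on `GL₁` with Hecke character `ν`, and its Satake family `{ν(ϖ_w)}`
  obtain ⟨N, hNν, -⟩ := CuspidalAutomorphicRepGL.exists_heckeCharacter_eq (μ := μ₁) ν hνu hνA
  obtain ⟨S₁, β₁, -, hβ₁⟩ := exists_isSatakeFamilyOf_holds (n := 1) (K := F) (μ := μ₁) N
  -- a common finite exceptional set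
  set T : Set (HeightOneSpectrum (𝓞 F)) := S ∪ ↑S₁ with hT
  have hTf : T.Finite := hS.union S₁.finite_toSet
  have hαT : IsSatakeFamilyOf π₀ T α := hα.mono Set.subset_union_left
  have hγT : IsSatakeFamilyOf P₀ T γ := hγ.mono Set.subset_union_left
  have hβT : IsSatakeFamilyOf N T β₁ := hβ₁.mono Set.subset_union_right
  -- (2.2) for `GL₄ × GL₁`: `L^T(s, P₀ × N)` has a finite limit at `s = 1`
  obtain ⟨c, -, hc⟩ := hrk (by norm_num) (by norm_num) (by norm_num) P₀ N hTf hγT hβT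
  -- (2.3) for `GL₂`: `L^T(s, π₀ × π̄₀)` has a pole at `s = 1`
  refine not_tendsto_partialPairL_conj_of_pole h23 (by norm_num) π₀ π₀.conj
    (by rw [CuspidalAutomorphicRepGL.conj_conj]) hTf hαT hαT.conj c ?_
  -- the two partial `L`-functions coincide factor by factor
  have hLL : partialPairL T γ β₁ = partialPairL T α fun v => (α v).map (starRingEnd ℂ) := by
    funext s
    simp only [partialPairL]
    refine tprod_congr fun w => ?_
    have hwS : w.1 ∉ S := fun hw => w.2 (Or.inl hw)
    have hwS₁ : w.1 ∉ (↑S₁ : Set (HeightOneSpectrum (𝓞 F))) := fun hw => w.2 (Or.inr hw)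
    -- `β₁(w) = {ν(ϖ_w)}`, `ν(ϖ_w) = (ψ(ϖ_w) det α(w))⁻¹`
    have hβw : β₁ w.1 = {(ψ.valueAtUniformizer w.1 * (α w.1).prod)⁻¹} := by
      rw [hβ₁.eq_singleton_valueAtUniformizer hwS₁, hNν, hν, vAU_inv, vAU_mul,
        (hω₀sat hα w.1 hwS).2]
    -- the entries of `α(w)` are non-zero (`|det α(w)| = 1`) and there are two of them
    obtain ⟨𝔫, -, -, ϖ, hSat⟩ := hαT w.1 w.2
    have hprod : (α w.1).prod ≠ 0 := fun h0 => by
      have := hSat.norm_prod_eq_one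
      rw [h0, norm_zero] at this
      exact zero_ne_one this
    have h0 : (0 : ℂ) ∉ α w.1 := fun hm => hprod (Multiset.prod_eq_zero hm)
    have hψ0 := vAU_ne_zero ψ w.1
    have key : satakeTensor (γ w.1) (β₁ w.1) =
        satakeTensor (α w.1) ((α w.1).map (starRingEnd ℂ)) := by
      rw [hβw, h w.1 hwS, satakeTensor_singleton_right', Multiset.map_map,
        ← hαT.map_inv_eq_map_conj w.2,
        ← satakeTensor_self_map_prod_inv_mul_of_card_eq_two (hαT.card_eq w.2) h0]
      refine Multiset.map_congr rfl fun x _ => ?_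
      simp only [Function.comp_apply]
      field_simp
    rw [satakePairPolynomial_eq_eulerPolynomial, satakePairPolynomial_eq_eulerPolynomial, key]
  rw [← hLL]
  exact hc

end L2Core

/-! ### The "only if" half of the criterion for Borel–Jacquet data -/

section BorelJacquet

variable {F : Type} [Field F] [NumberField F]

/-- A cofinite `∀ᶠ` is a `∀` off a finite set. [folklore] -/
private theorem exists_finite_forall_of_eventually_cofinite {ι : Type*} {p : ι → Prop}
    (h : ∀ᶠ i in cofinite, p i) : ∃ T : Set ι, T.Finite ∧ ∀ i ∉ T, p i :=
  ⟨{i | ¬ p i}, Filter.eventually_cofinite.1 h, fun _ hi => not_not.1 hi⟩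

/-- Cancelling a non-zero scalar: `c · X = d · Y` with `d ≠ 0` gives `Y = (d⁻¹ c) · X`. [folklore] -/
private theorem eq_map_of_map_mul_eq_map_mul {X Y : Multiset ℂ} {c d : ℂ} (hd : d ≠ 0)
    (h : X.map (c * ·) = Y.map (d * ·)) : Y = X.map ((d⁻¹ * c) * ·) := by
  have h' := congrArg (Multiset.map (d⁻¹ * ·)) h
  simp only [Multiset.map_map, Function.comp_def, ← mul_assoc, inv_mul_cancel₀ hd, one_mul,
    Multiset.map_id'] at h'
  exact h'.symm

/-- **Theorem M, cuspidality criterion, "only if" half, for Borel–Jacquet data, from the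
Jacquet–Shalika leaves and the unitary normalisation** (Ramakrishnan 2000, Theorem M with §3.2,
proof of Prop. 3.2.1, preprint p. 14: "Suppose `π' ≃ π ⊗ χ`, for an idele class character `χ` of
`F`. Then, by [JS2] and `(L_v)` for almost all `v`, `L^S(s, π ⊠ π' ⊗ (χω)⁻¹)` must have a pole at
`s = 1` … Then `π ⊠ π'` cannot be cuspidal"). For cuspidal `π, π'` on `GL(2)/F` (Borel–Jacquet data,
arbitrary central characters) with `π' ≃ π ⊗ χ` at the level of Satake parameters a.e.
(`IsSatakeTwistBy π π' χ`), **no cuspidal** `Π` on `GL(4)/F` has the Satake parameters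
`t_{π,v} ⊗ t_{π',v}` at almost all `v` — the negation of condition (C) excludes cuspidality of
`π ⊠ π'`, in the rendering of `Ramakrishnan2000_theoremM`. Inputs, as hypotheses: Jacquet–Shalika
(2.2) at `s = 1` for `GL₄ × GL₁` and (2.3) for `GL₂` in the tree's `L²` model
(`JacquetShalika1981_partialPairL_at_one_of_rank_ne`, `…_pole_of_eq_conj` of `PairLFunctionPoles`,
named facts; Jacquet–Shalika II, Prop. 3.6) and the unitary normalisation `hN` of cuspidal
Borel–Jacquet data ("`π = π₀ ⊗ |det|^s` with `π₀` unitary", Borel–Jacquet 1979, 5.7; the hypothesis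
shared with `ArthurClozel_fibres_quadratic_of_normalisation` and
`JacquetShalika1981_partialPairL_pole_repData_of_normalisation`, supplied from the realisation leaves in
`…_of_realisation_leaves` below). Proof: normalise `t_π = q^{s₁} t_{π₀}`, `t_Π = q^{s₃} t_{P₀}`
(`hN`, automorphic measures by `exists_isAutomorphicMeasure_gl_holds`); off a finite set the two
a.e. relations give `t_{P₀} = ψ(ϖ) (t_{π₀} ⊗ t_{π₀})` with `ψ = χ ‖·‖^{s₃ - 2s₁}`
(`exists_heckeCharacter_ideleNorm_cpow`), and `CuspidalAutomorphicRepGL.false_of_satakeTensor_self_twist`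
applies. [cite: Ramakrishnan2000, Theorem M (§3) and §3.2, proof of Prop. 3.2.1 (preprint p. 14)]
[cite: ArthurClozelAMS120, Ch. 3 §2 (2.2)–(2.3)] [cite: BorelJacquetCorvallis1979, 5.7] -/
theorem Ramakrishnan2000_theoremM.not_exists_cuspidal_of_isSatakeTwistBy_of_normalisation
    (hrk : ∀ {μ : Measure (gl 4 F).automorphicQuotient} [(gl 4 F).IsAutomorphicMeasure μ]
      {μ' : Measure (gl 1 F).automorphicQuotient} [(gl 1 F).IsAutomorphicMeasure μ'],
      JacquetShalika1981_partialPairL_at_one_of_rank_ne (n := 4) (m := 1) (K := F) (μ := μ)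
        (μ' := μ'))
    (h23 : ∀ {μ : Measure (gl 2 F).automorphicQuotient} [(gl 2 F).IsAutomorphicMeasure μ],
      JacquetShalika1981_partialPairL_pole_of_eq_conj (n := 2) (K := F) (μ := μ))
    (hN : ∀ {n : ℕ} [NeZero n] (hK : isCompact_glFiniteIntegralLevel n F)
      (μ : Measure (gl n F).automorphicQuotient) [(gl n F).IsAutomorphicMeasure μ]
      (π : CuspidalAutomorphicRepData n F hK),
      ∃ (s : ℂ) (P : CuspidalAutomorphicRepGL n F μ) (S : Set (HeightOneSpectrum (𝓞 F)))
        (αP : SatakeFamily F), S.Finite ∧ IsSatakeFamilyOf P S αP ∧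
        ∀ w ∉ S, ∀ β : Multiset ℂ,
          π.1.HasSatakeParamAt w β ↔ β = (αP w).map (((w.residueCard : ℂ) ^ s) * ·))
    (h2 : isCompact_glFiniteIntegralLevel 2 F) (h4 : isCompact_glFiniteIntegralLevel 4 F)
    (π π' : CuspidalAutomorphicRepData 2 F h2) {χ : HeckeCharacter F}
    (hχ : IsSatakeTwistBy π.1 π'.1 χ) :
    ¬ ∃ P : CuspidalAutomorphicRepData 4 F h4,
      ∀ᶠ v : HeightOneSpectrum (𝓞 F) in cofinite, ∀ α β : Multiset ℂ,
        π.1.HasSatakeParamAt v α → π'.1.HasSatakeParamAt v β →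
          P.1.HasSatakeParamAt v (satakeTensor α β) := by
  classical
  rintro ⟨P, hP⟩
  obtain ⟨μ₂, hμ₂⟩ := AdelicGroupData.exists_isAutomorphicMeasure_gl_holds 2 F
  obtain ⟨μ₄, hμ₄⟩ := AdelicGroupData.exists_isAutomorphicMeasure_gl_holds 4 F
  obtain ⟨μ₁, hμ₁⟩ := AdelicGroupData.exists_isAutomorphicMeasure_gl_holds 1 F
  haveI := hμ₂
  haveI := hμ₄
  haveI := hμ₁
  -- unitary normalisations of `π` (on `GL₂`) and of `P` (on `GL₄`)
  obtain ⟨s₁, π₀, Sa, α₀, hSa, hα₀, hiffπ⟩ := hN h2 μ₂ π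
  obtain ⟨s₃, P₀, Sb, γ₀, hSb, hγ₀, hiffP⟩ := hN h4 μ₄ P
  -- a finite set off which both almost-everywhere relations hold
  obtain ⟨T₀, hT₀f, hT₀⟩ := exists_finite_forall_of_eventually_cofinite (hP.and hχ)
  have hTf : (Sa ∪ Sb ∪ T₀).Finite := (hSa.union hSb).union hT₀f
  -- the norm power `η = ‖·‖^{s₃ - 2 s₁}`; the twisting character in the `L²` model is `ψ = χ η`
  obtain ⟨η, hη⟩ := exists_heckeCharacter_ideleNorm_cpow F (s₃ - 2 * s₁)
  refine CuspidalAutomorphicRepGL.false_of_satakeTensor_self_twist (μ₁ := μ₁) hrk h23 π₀ P₀ hTf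
    (hα₀.mono (Set.subset_union_left.trans Set.subset_union_left))
    (hγ₀.mono (Set.subset_union_right.trans Set.subset_union_left)) (χ * η) fun w hw => ?_
  have hwa : w ∉ Sa := fun h => hw (Or.inl (Or.inl h))
  have hwb : w ∉ Sb := fun h => hw (Or.inl (Or.inr h))
  obtain ⟨hgoodP, hgoodχ⟩ := hT₀ w fun h => hw (Or.inr h)
  have hq0 : (w.residueCard : ℂ) ≠ 0 := by
    exact_mod_cast (Nat.zero_lt_of_lt w.one_lt_residueCard).ne'
  have hqs : ∀ t : ℂ, (w.residueCard : ℂ) ^ t ≠ 0 := fun t h0 =>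
    hq0 ((Complex.cpow_eq_zero_iff _ _).1 h0).1
  -- `t_{π,w} = q^{s₁} α₀(w)`, `t_{π',w} = χ(ϖ_w) t_{π,w}`, `t_{P,w} = t_{π,w} ⊗ t_{π',w} = q^{s₃} γ₀(w)`
  have hπw : π.1.HasSatakeParamAt w ((α₀ w).map (((w.residueCard : ℂ) ^ s₁) * ·)) :=
    (hiffπ w hwa _).2 rfl
  have hrel := (hiffP w hwb _).1 (hgoodP _ _ hπw (hgoodχ _ hπw))
  have e1 : ((α₀ w).map (((w.residueCard : ℂ) ^ s₁) * ·)).map (χ.valueAtUniformizer w * ·) =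
      (α₀ w).map ((χ.valueAtUniformizer w * (w.residueCard : ℂ) ^ s₁) * ·) := by
    rw [Multiset.map_map]
    exact Multiset.map_congr rfl fun x _ => by simp only [Function.comp_apply, mul_assoc]
  rw [e1, satakeTensor_map_mul_map_mul] at hrel
  rw [eq_map_of_map_mul_eq_map_mul (hqs s₃) hrel]
  refine Multiset.map_congr rfl fun x _ => ?_
  rw [vAU_mul, vAU_of_forall_apply_eq_cpow hη, show -(s₃ - 2 * s₁) = -s₃ + (s₁ + s₁) by ring,
    Complex.cpow_add _ _ hq0, Complex.cpow_add _ _ hq0, Complex.cpow_neg]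
  ring

/-- **The same on the realisation leaves.** The "only if" half of the criterion for Borel–Jacquet
data, granting Jacquet–Shalika (2.2) for `GL₄ × GL₁` at `s = 1` and (2.3) for `GL₂` (`L²` facts) and
the two leaves of the unitary normalisation: the realisation of clean cuspidal data in `L²_cusp`
(`AutomorphicRepsGL.exists_le_formsOfL2_of_W'_eq_bot`) and clean models
(`AutomorphicRepsGL.stable_cuspidal_eq_sSup_irreducible`), through
`CuspidalAutomorphicRepData.exists_satake_eq_cpow_mul_L2_of_realisation`.
[cite: Ramakrishnan2000, Theorem M (§3) and §3.2, proof of Prop. 3.2.1 (preprint p. 14)]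
[cite: BorelJacquetCorvallis1979, 5.7] -/
theorem Ramakrishnan2000_theoremM.not_exists_cuspidal_of_isSatakeTwistBy_of_realisation_leaves
    (hrk : ∀ {μ : Measure (gl 4 F).automorphicQuotient} [(gl 4 F).IsAutomorphicMeasure μ]
      {μ' : Measure (gl 1 F).automorphicQuotient} [(gl 1 F).IsAutomorphicMeasure μ'],
      JacquetShalika1981_partialPairL_at_one_of_rank_ne (n := 4) (m := 1) (K := F) (μ := μ)
        (μ' := μ'))
    (h23 : ∀ {μ : Measure (gl 2 F).automorphicQuotient} [(gl 2 F).IsAutomorphicMeasure μ],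
      JacquetShalika1981_partialPairL_pole_of_eq_conj (n := 2) (K := F) (μ := μ))
    (hre : ∀ {n : ℕ} {K : Type} [Field K] [NumberField K] (hK : isCompact_glFiniteIntegralLevel n K)
      (μ : Measure (gl n K).automorphicQuotient) [(gl n K).IsAutomorphicMeasure μ],
      AutomorphicRepsGL.exists_le_formsOfL2_of_W'_eq_bot hK μ)
    (hss : ∀ {n : ℕ} {K : Type} [Field K] [NumberField K] (hK : isCompact_glFiniteIntegralLevel n K),
      AutomorphicRepsGL.stable_cuspidal_eq_sSup_irreducible hK)
    (h2 : isCompact_glFiniteIntegralLevel 2 F) (h4 : isCompact_glFiniteIntegralLevel 4 F)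
    (π π' : CuspidalAutomorphicRepData 2 F h2) {χ : HeckeCharacter F}
    (hχ : IsSatakeTwistBy π.1 π'.1 χ) :
    ¬ ∃ P : CuspidalAutomorphicRepData 4 F h4,
      ∀ᶠ v : HeightOneSpectrum (𝓞 F) in cofinite, ∀ α β : Multiset ℂ,
        π.1.HasSatakeParamAt v α → π'.1.HasSatakeParamAt v β →
          P.1.HasSatakeParamAt v (satakeTensor α β) :=
  Ramakrishnan2000_theoremM.not_exists_cuspidal_of_isSatakeTwistBy_of_normalisation hrk h23
    (fun hK μ _ π => CuspidalAutomorphicRepData.exists_satake_eq_cpow_mul_L2_of_realisation hre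
      (fun hK _ π => CuspidalAutomorphicRepData.exists_clean_hasSatakeParamAt_of_sSup_irreducible
        (hss hK) π) hK μ π)
    h2 h4 π π' hχ

end BorelJacquet

/-! ### Theorem M from the cuspidal-case fact, the degenerate Existence clause and the leaves -/

section Assembly

/-- **Assembly.** `Ramakrishnan2000_theoremM` follows from the cuspidal-case fact
`Ramakrishnan2000_boxTimes_cuspidal` (Existence + "if" half of the criterion), the Existence clause
(R1) for *every* cuspidal pair (op. cit. Lemma 3.1.1 (II), (III): isobaric sums and automorphic
induction, absent from the tree — kept as an inline hypothesis), and — replacing the inline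
hypothesis (R2) of `Ramakrishnan2000_theoremM.of_boxTimes_cuspidal` — the Jacquet–Shalika leaves
(2.2) (`s = 1`, different ranks) and (2.3) in the `L²` model together with the unitary
normalisation of cuspidal Borel–Jacquet data.
[cite: Ramakrishnan2000, Theorem M (§3), Lemma 3.1.1 and Prop. 3.2.1] -/
theorem Ramakrishnan2000_theoremM.of_boxTimes_cuspidal_of_normalisation
    (h : Ramakrishnan2000_boxTimes_cuspidal)
    (hR1 : ∀ (F : Type) [Field F] [NumberField F]
      (h2 : isCompact_glFiniteIntegralLevel 2 F) (h4 : isCompact_glFiniteIntegralLevel 4 F)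
      (π π' : CuspidalAutomorphicRepData 2 F h2),
      ∃ P : AutomorphicRepData (AutomorphyDatum.gl 4 F h4),
        ∀ᶠ v : HeightOneSpectrum (𝓞 F) in cofinite, ∀ α β : Multiset ℂ,
          π.1.HasSatakeParamAt v α → π'.1.HasSatakeParamAt v β →
            P.HasSatakeParamAt v (satakeTensor α β))
    (hrk : ∀ {n m : ℕ} {K : Type} [Field K] [NumberField K]
      {μ : Measure (gl n K).automorphicQuotient} [(gl n K).IsAutomorphicMeasure μ]
      {μ' : Measure (gl m K).automorphicQuotient} [(gl m K).IsAutomorphicMeasure μ'],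
      JacquetShalika1981_partialPairL_at_one_of_rank_ne (n := n) (m := m) (K := K) (μ := μ)
        (μ' := μ'))
    (h23 : ∀ {n : ℕ} {K : Type} [Field K] [NumberField K] {μ : Measure (gl n K).automorphicQuotient}
      [(gl n K).IsAutomorphicMeasure μ],
      JacquetShalika1981_partialPairL_pole_of_eq_conj (n := n) (K := K) (μ := μ))
    (hN : ∀ {n : ℕ} {K : Type} [Field K] [NumberField K] [NeZero n]
      (hK : isCompact_glFiniteIntegralLevel n K) (μ : Measure (gl n K).automorphicQuotient)
      [(gl n K).IsAutomorphicMeasure μ] (π : CuspidalAutomorphicRepData n K hK),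
      ∃ (s : ℂ) (P : CuspidalAutomorphicRepGL n K μ) (S : Set (HeightOneSpectrum (𝓞 K)))
        (αP : SatakeFamily K), S.Finite ∧ IsSatakeFamilyOf P S αP ∧
        ∀ w ∉ S, ∀ β : Multiset ℂ,
          π.1.HasSatakeParamAt w β ↔ β = (αP w).map (((w.residueCard : ℂ) ^ s) * ·)) :
    Ramakrishnan2000_theoremM :=
  Ramakrishnan2000_theoremM.of_boxTimes_cuspidal h hR1 fun _ _ _ h2 h4 π π' _ hχ =>
    Ramakrishnan2000_theoremM.not_exists_cuspidal_of_isSatakeTwistBy_of_normalisation hrk h23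
      (fun hK μ _ π => hN hK μ π) h2 h4 π π' hχ

/-- **Assembly on the realisation leaves**: `Ramakrishnan2000_theoremM` from
`Ramakrishnan2000_boxTimes_cuspidal`, the Existence clause (R1), the `L²` facts Jacquet–Shalika (2.2)
(`s = 1`, different ranks) and (2.3), and the two leaves `exists_le_formsOfL2_of_W'_eq_bot`,
`stable_cuspidal_eq_sSup_irreducible` of the Borel–Jacquet dictionary.
[cite: Ramakrishnan2000, Theorem M (§3), Lemma 3.1.1 and Prop. 3.2.1] -/
theorem Ramakrishnan2000_theoremM.of_boxTimes_cuspidal_of_realisation_leaves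
    (h : Ramakrishnan2000_boxTimes_cuspidal)
    (hR1 : ∀ (F : Type) [Field F] [NumberField F]
      (h2 : isCompact_glFiniteIntegralLevel 2 F) (h4 : isCompact_glFiniteIntegralLevel 4 F)
      (π π' : CuspidalAutomorphicRepData 2 F h2),
      ∃ P : AutomorphicRepData (AutomorphyDatum.gl 4 F h4),
        ∀ᶠ v : HeightOneSpectrum (𝓞 F) in cofinite, ∀ α β : Multiset ℂ,
          π.1.HasSatakeParamAt v α → π'.1.HasSatakeParamAt v β →
            P.HasSatakeParamAt v (satakeTensor α β))
    (hrk : ∀ {n m : ℕ} {K : Type} [Field K] [NumberField K]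
      {μ : Measure (gl n K).automorphicQuotient} [(gl n K).IsAutomorphicMeasure μ]
      {μ' : Measure (gl m K).automorphicQuotient} [(gl m K).IsAutomorphicMeasure μ'],
      JacquetShalika1981_partialPairL_at_one_of_rank_ne (n := n) (m := m) (K := K) (μ := μ)
        (μ' := μ'))
    (h23 : ∀ {n : ℕ} {K : Type} [Field K] [NumberField K] {μ : Measure (gl n K).automorphicQuotient}
      [(gl n K).IsAutomorphicMeasure μ],
      JacquetShalika1981_partialPairL_pole_of_eq_conj (n := n) (K := K) (μ := μ))
    (hre : ∀ {n : ℕ} {K : Type} [Field K] [NumberField K] (hK : isCompact_glFiniteIntegralLevel n K)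
      (μ : Measure (gl n K).automorphicQuotient) [(gl n K).IsAutomorphicMeasure μ],
      AutomorphicRepsGL.exists_le_formsOfL2_of_W'_eq_bot hK μ)
    (hss : ∀ {n : ℕ} {K : Type} [Field K] [NumberField K] (hK : isCompact_glFiniteIntegralLevel n K),
      AutomorphicRepsGL.stable_cuspidal_eq_sSup_irreducible hK) :
    Ramakrishnan2000_theoremM :=
  Ramakrishnan2000_theoremM.of_boxTimes_cuspidal h hR1 fun _ _ _ h2 h4 π π' _ hχ =>
    Ramakrishnan2000_theoremM.not_exists_cuspidal_of_isSatakeTwistBy_of_realisation_leaves hrk h23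
      hre hss h2 h4 π π' hχ

end Assembly

/-! ### Lemma 3.1.1: the Existence clause outside the general type; the realisation leaf discharged -/

section SpecialTypes

variable {F : Type} [Field F] [NumberField F]

/-- **Existence of `π ⊠ π'` for every cuspidal pair, by the case split of Lemma 3.1.1**
(Ramakrishnan 2000, §3.1, Lemma 3.1.1, preprint pp. 10–11: "Theorem M holds in the following three
special cases: (I) At least one of `{π, π'}` is not cuspidal. (II) At least one of `{π, π'}` is
automorphically induced by a character `μ` of (the idele class group of) a quadratic extension `K`
of `F`. (III) `π'` is a twist of `π`, i.e., there exists a character `χ` of `C_F` such that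
`π' ≃ π ⊗ χ`. […] We will say that `(π, π')` is of general type if we are not in either of these
three special cases", and §3.7: Theorem M for pairs of general type). For cuspidal Borel–Jacquet
data `π, π'` on `GL(2)/F` case (I) is void; (II) is rendered by `IsSatakeSelfTwist` (op. cit.
Prop. 2.3.1 (2)) and, `satakeTensor` being commutative, it suffices to treat a self-twisting `π`;
(III) for `π, π'` without self-twists is `IsSatakeTwistBy π π' χ`; and the general type is the
cuspidal-case fact `Ramakrishnan2000_boxTimes_cuspidal` (through
`Ramakrishnan2000_theoremM.exists_cuspidal_of_boxTimes_cuspidal`). Granting the fact and the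
Existence clause in the special types (II), (III) — hypotheses `hII`, `hIII`, whose printed proofs
`π ⊠ I(μ) = I_K^F(π_K ⊗ μ)`, `π ⊠ (π ⊗ χ) = (sym²(π) ⊗ χ) ⊞ ωχ` use automorphic induction of
`GL(2)` data and isobaric sums, not available in the tree — some automorphic `Π` on `GL(4)/F` has
the Satake parameters `t_{π,v} ⊗ t_{π',v}` at almost all `v`, for **every** cuspidal pair.
[cite: Ramakrishnan2000, Lemma 3.1.1 (§3.1) and Theorem M (§3.7)] -/
theorem Ramakrishnan2000_theoremM.exists_of_boxTimes_cuspidal_of_special_types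
    (h : Ramakrishnan2000_boxTimes_cuspidal)
    (hII : ∀ (F : Type) [Field F] [NumberField F]
      (h2 : isCompact_glFiniteIntegralLevel 2 F) (h4 : isCompact_glFiniteIntegralLevel 4 F)
      (π π' : CuspidalAutomorphicRepData 2 F h2), IsSatakeSelfTwist π.1 →
      ∃ P : AutomorphicRepData (AutomorphyDatum.gl 4 F h4),
        ∀ᶠ v : HeightOneSpectrum (𝓞 F) in cofinite, ∀ α β : Multiset ℂ,
          π.1.HasSatakeParamAt v α → π'.1.HasSatakeParamAt v β →
            P.HasSatakeParamAt v (satakeTensor α β))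
    (hIII : ∀ (F : Type) [Field F] [NumberField F]
      (h2 : isCompact_glFiniteIntegralLevel 2 F) (h4 : isCompact_glFiniteIntegralLevel 4 F)
      (π π' : CuspidalAutomorphicRepData 2 F h2) (χ : HeckeCharacter F),
      ¬ IsSatakeSelfTwist π.1 → ¬ IsSatakeSelfTwist π'.1 → IsSatakeTwistBy π.1 π'.1 χ →
      ∃ P : AutomorphicRepData (AutomorphyDatum.gl 4 F h4),
        ∀ᶠ v : HeightOneSpectrum (𝓞 F) in cofinite, ∀ α β : Multiset ℂ,
          π.1.HasSatakeParamAt v α → π'.1.HasSatakeParamAt v β →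
            P.HasSatakeParamAt v (satakeTensor α β))
    (h2 : isCompact_glFiniteIntegralLevel 2 F) (h4 : isCompact_glFiniteIntegralLevel 4 F)
    (π π' : CuspidalAutomorphicRepData 2 F h2) :
    ∃ P : AutomorphicRepData (AutomorphyDatum.gl 4 F h4),
      ∀ᶠ v : HeightOneSpectrum (𝓞 F) in cofinite, ∀ α β : Multiset ℂ,
        π.1.HasSatakeParamAt v α → π'.1.HasSatakeParamAt v β →
          P.HasSatakeParamAt v (satakeTensor α β) := by
  by_cases hπ : IsSatakeSelfTwist π.1
  · exact hII F h2 h4 π π' hπ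
  by_cases hπ' : IsSatakeSelfTwist π'.1
  · -- (II) for `π'`: transport along `t ⊗ t' = t' ⊗ t`
    obtain ⟨P, hP⟩ := hII F h2 h4 π' π hπ'
    refine ⟨P, hP.mono fun v hv α β hα hβ => ?_⟩
    rw [satakeTensor_comm]
    exact hv β α hβ hα
  by_cases hC : ∃ χ : HeckeCharacter F, IsSatakeTwistBy π.1 π'.1 χ
  · obtain ⟨χ, hχ⟩ := hC
    exact hIII F h2 h4 π π' χ hπ hπ' hχ
  · -- general type: the cuspidal `π ⊠ π'` of the fact
    obtain ⟨P, hP⟩ :=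
      Ramakrishnan2000_theoremM.exists_cuspidal_of_boxTimes_cuspidal h h2 h4 π π' hπ hπ' hC
    exact ⟨P.1, hP⟩

/-- **(R2) for Borel–Jacquet data with the realisation leaf discharged.** The "only if" half of the
cuspidality criterion (`π ⊠ (π ⊗ χ)` is never cuspidal; op. cit. §3.2, proof of Prop. 3.2.1,
preprint p. 14), granting only Jacquet–Shalika (2.2) for `GL₄ × GL₁` at `s = 1` and (2.3) for `GL₂`
(`L²` facts) and the semisimplicity leaf `AutomorphicRepsGL.stable_cuspidal_eq_sSup_irreducible`:
the realisation leaf of `…_of_realisation_leaves` is the theorem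
`AutomorphicRepsGL.exists_le_formsOfL2_of_W'_eq_bot_holds`.
[cite: Ramakrishnan2000, Theorem M (§3) and §3.2, proof of Prop. 3.2.1 (preprint p. 14)]
[cite: BorelJacquetCorvallis1979, 4.6 and 5.7] -/
theorem Ramakrishnan2000_theoremM.not_exists_cuspidal_of_isSatakeTwistBy_of_semisimple
    (hrk : ∀ {μ : Measure (gl 4 F).automorphicQuotient} [(gl 4 F).IsAutomorphicMeasure μ]
      {μ' : Measure (gl 1 F).automorphicQuotient} [(gl 1 F).IsAutomorphicMeasure μ'],
      JacquetShalika1981_partialPairL_at_one_of_rank_ne (n := 4) (m := 1) (K := F) (μ := μ)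
        (μ' := μ'))
    (h23 : ∀ {μ : Measure (gl 2 F).automorphicQuotient} [(gl 2 F).IsAutomorphicMeasure μ],
      JacquetShalika1981_partialPairL_pole_of_eq_conj (n := 2) (K := F) (μ := μ))
    (hss : ∀ {n : ℕ} {K : Type} [Field K] [NumberField K] (hK : isCompact_glFiniteIntegralLevel n K),
      AutomorphicRepsGL.stable_cuspidal_eq_sSup_irreducible hK)
    (h2 : isCompact_glFiniteIntegralLevel 2 F) (h4 : isCompact_glFiniteIntegralLevel 4 F)
    (π π' : CuspidalAutomorphicRepData 2 F h2) {χ : HeckeCharacter F}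
    (hχ : IsSatakeTwistBy π.1 π'.1 χ) :
    ¬ ∃ P : CuspidalAutomorphicRepData 4 F h4,
      ∀ᶠ v : HeightOneSpectrum (𝓞 F) in cofinite, ∀ α β : Multiset ℂ,
        π.1.HasSatakeParamAt v α → π'.1.HasSatakeParamAt v β →
          P.1.HasSatakeParamAt v (satakeTensor α β) :=
  Ramakrishnan2000_theoremM.not_exists_cuspidal_of_isSatakeTwistBy_of_realisation_leaves hrk h23
    (fun _ _ _ => AutomorphicRepsGL.exists_le_formsOfL2_of_W'_eq_bot_holds) hss h2 h4 π π' hχ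

/-- **Theorem M from the cuspidal-case fact, Lemma 3.1.1 (II), (III) and three named facts.**
`Ramakrishnan2000_theoremM` follows from `Ramakrishnan2000_boxTimes_cuspidal` (Theorem M for pairs
of general type: Existence and the "if" half of the criterion), the Existence clause in the special
types (II), (III) of Lemma 3.1.1 (hypotheses `hII`, `hIII` of
`exists_of_boxTimes_cuspidal_of_special_types`), the `L²` facts Jacquet–Shalika (2.2) (`s = 1`,
different ranks) and (2.3), and the semisimplicity leaf
`AutomorphicRepsGL.stable_cuspidal_eq_sSup_irreducible` — the realisation leaf of
`…_of_realisation_leaves` being discharged by `AutomorphicRepsGL.exists_le_formsOfL2_of_W'_eq_bot_holds`.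
[cite: Ramakrishnan2000, Theorem M (§3), Lemma 3.1.1 and Prop. 3.2.1] -/
theorem Ramakrishnan2000_theoremM.of_boxTimes_cuspidal_of_special_types
    (h : Ramakrishnan2000_boxTimes_cuspidal)
    (hII : ∀ (F : Type) [Field F] [NumberField F]
      (h2 : isCompact_glFiniteIntegralLevel 2 F) (h4 : isCompact_glFiniteIntegralLevel 4 F)
      (π π' : CuspidalAutomorphicRepData 2 F h2), IsSatakeSelfTwist π.1 →
      ∃ P : AutomorphicRepData (AutomorphyDatum.gl 4 F h4),
        ∀ᶠ v : HeightOneSpectrum (𝓞 F) in cofinite, ∀ α β : Multiset ℂ,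
          π.1.HasSatakeParamAt v α → π'.1.HasSatakeParamAt v β →
            P.HasSatakeParamAt v (satakeTensor α β))
    (hIII : ∀ (F : Type) [Field F] [NumberField F]
      (h2 : isCompact_glFiniteIntegralLevel 2 F) (h4 : isCompact_glFiniteIntegralLevel 4 F)
      (π π' : CuspidalAutomorphicRepData 2 F h2) (χ : HeckeCharacter F),
      ¬ IsSatakeSelfTwist π.1 → ¬ IsSatakeSelfTwist π'.1 → IsSatakeTwistBy π.1 π'.1 χ →
      ∃ P : AutomorphicRepData (AutomorphyDatum.gl 4 F h4),
        ∀ᶠ v : HeightOneSpectrum (𝓞 F) in cofinite, ∀ α β : Multiset ℂ,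
          π.1.HasSatakeParamAt v α → π'.1.HasSatakeParamAt v β →
            P.HasSatakeParamAt v (satakeTensor α β))
    (hrk : ∀ {n m : ℕ} {K : Type} [Field K] [NumberField K]
      {μ : Measure (gl n K).automorphicQuotient} [(gl n K).IsAutomorphicMeasure μ]
      {μ' : Measure (gl m K).automorphicQuotient} [(gl m K).IsAutomorphicMeasure μ'],
      JacquetShalika1981_partialPairL_at_one_of_rank_ne (n := n) (m := m) (K := K) (μ := μ)
        (μ' := μ'))
    (h23 : ∀ {n : ℕ} {K : Type} [Field K] [NumberField K] {μ : Measure (gl n K).automorphicQuotient}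
      [(gl n K).IsAutomorphicMeasure μ],
      JacquetShalika1981_partialPairL_pole_of_eq_conj (n := n) (K := K) (μ := μ))
    (hss : ∀ {n : ℕ} {K : Type} [Field K] [NumberField K] (hK : isCompact_glFiniteIntegralLevel n K),
      AutomorphicRepsGL.stable_cuspidal_eq_sSup_irreducible hK) :
    Ramakrishnan2000_theoremM :=
  Ramakrishnan2000_theoremM.of_boxTimes_cuspidal_of_realisation_leaves h
    (fun _ _ _ h2 h4 π π' =>
      Ramakrishnan2000_theoremM.exists_of_boxTimes_cuspidal_of_special_types h hII hIII h2 h4 π π')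
    hrk h23 (fun _ _ _ => AutomorphicRepsGL.exists_le_formsOfL2_of_W'_eq_bot_holds) hss

end SpecialTypes

end Literature.NumberTheory.Automorphic

end
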